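import Summits.RiemannHypothesis.RiemannHypothesis.Theorems.IntegerScrewCensusDualCell

/-!
# Route `IntegerScrew` — kernel checker for the census DUAL certificates (11): `cellCheck` is sound

If a cell passes `cellCheck` with slacks dominating the three error budgets and `Λ` dominating the cubic term, and the
analytic hypotheses `CellHyp` hold at the cell centre `t₀ = 4c + 2`, then `Q_Z(4c + 4τ) ≥ 0` for every
`τ ∈ [mstart/M, mend/M]` (`horner_value` + the three model bounds + `qSum_step` fed into `walk_sound`).
RH-free; nothing here bears on the truth of RH.
-/

set_option linter.dupNamespace false
set_option autoImplicit false

namespace Summit.RiemannHypothesis.RiemannHypothesis.Theorems.IntegerScrew.Manifest.Fast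

open Finset Complex

/-- **Soundness of one cell.** -/
theorem cell_sound {D' E : ℕ} {Z : List (List ℤ)} {φs : List ℕ} {vals : List (ℕ × ℕ)} {ν : ℕ → ℝ} {U c1 : ℝ}
    {Wm c Lam fuel mstart mend : ℕ} {S : ℕ × ℕ × ℕ}
    (H : CellHyp Z φs (vals.map xyOf) ν (4 * (c : ℝ) + 2) U c1 Wm) (hc1 : c1 ≤ ((D' : ℝ) + 1) / 2) (hc16 : c1 ≤ 16)
    (hdig : ∀ k, k < D' + 1 + 1 → |dRE (kConsts (D' + 1) E) Z φs (vals.map xyOf) k| < 2 ^ (SW - 1) ∧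
      |dIM (kConsts (D' + 1) E) Z φs (vals.map xyOf) k| < 2 ^ (SW - 1))
    (hS0 : (MR : ℝ) ^ (D' + 1) * (ampA Z * ((K0N (D' + 1) E : ℝ) * (31 * U * (1 + 2 * c1 ^ D' / (D').factorial) +
      2 * c1 ^ D' / (D').factorial + (Wm : ℝ) / 2 ^ 46) + ((D' : ℝ) + 2) * 2 ^ 105)) ≤ (S.1 : ℝ))
    (hS1 : (MR : ℝ) ^ (D' + 1) * (2 * (ampA Z * ((K0N (D' + 1) E : ℝ) * (c1 * (31 * U * (1 + 2 * c1 ^ D' / (D').factorial) +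
      2 * c1 ^ D' / (D').factorial) + (Wm : ℝ) / 2 ^ 46 * (1 + c1)) + ((D' : ℝ) + 2) ^ 2 * 2 ^ 105))) ≤ (S.2.1 : ℝ))
    (hS2 : (MR : ℝ) ^ (D' + 1) * (4 * (ampA Z * ((K0N (D' + 1) E : ℝ) * (c1 ^ 2 * (31 * U * (1 + 2 * c1 ^ D' / (D').factorial) +
      2 * c1 ^ D' / (D').factorial) + (Wm : ℝ) / 2 ^ 46 * (2 * c1 + c1 ^ 2)) + ((D' : ℝ) + 3) ^ 3 * 2 ^ 105))) ≤ (S.2.2 : ℝ))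
    (hLam : (MR : ℝ) ^ (D' + 1) * (K0N (D' + 1) E : ℝ) * ((64 / 3) * ampC Z ν) ≤ (Lam : ℝ))
    (hcell : cellCheck (D' + 1) (halfPack (D' + 1)) (nodeData (kConsts (D' + 1) E) Z φs) (constQ Z * ((K0N (D' + 1) E : ℕ) : ℤ))
      S Lam vals mstart mend fuel = true)
    (hms : mstart < mend) (hmend : mend ≤ MR) :
    ∀ τ : ℝ, (mstart : ℝ) / MR ≤ τ → τ ≤ (mend : ℝ) / MR →
      0 ≤ (constQ Z : ℝ) + qSum Z ν fun μ => Real.cos ((4 * (c : ℝ) + 4 * τ) * μ) := by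
  unfold cellCheck at hcell
  simp only at hcell
  set xys := vals.map xyOf with hxys
  set G := gList (D' + 1) (halfPack (D' + 1)) (accNodes xys (nodeData (kConsts (D' + 1) E) Z φs) xys)
    (constQ Z * ((K0N (D' + 1) E : ℕ) : ℤ)) with hG
  set Hl := tauPoly G with hHl
  set K : ℝ := (MR : ℝ) ^ (D' + 1) * (K0N (D' + 1) E : ℝ) with hK
  have hK0 : (0 : ℝ) < (K0N (D' + 1) E : ℝ) := by
    unfold K0N; exact_mod_cast Nat.mul_pos (Nat.pow_pos (by norm_num)) (Nat.factorial_pos _)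
  have hMR : (0 : ℝ) < MR := by norm_num [MR]
  have hKpos : 0 < K := mul_pos (pow_pos hMR _) hK0
  have hMD : (0 : ℝ) ≤ (MR : ℝ) ^ (D' + 1) := by positivity
  have hlenG : G.length = D' + 1 + 1 := length_gList _ _ _ _
  have hlenH : Hl.length = D' + 1 + 1 := by rw [hHl, length_tauPoly, hlenG]
  have hν8 : ∀ a, a < Z.length → |ν a| ≤ 8 := fun a ha => by
    rw [abs_of_nonneg (H.ν0 a ha)]; linarith [H.νc a ha]
  -- σ of a dyadic point
  have hσ : ∀ m : ℕ, m < mend → |2 * ((m : ℝ) / MR) - 1| ≤ 1 := fun m hm => by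
    have h1 : (m : ℝ) / MR < 1 := by
      rw [div_lt_one hMR]; exact_mod_cast (lt_of_lt_of_le hm hmend)
    have h0 : 0 ≤ (m : ℝ) / MR := by positivity
    rw [abs_le]; constructor <;> linarith
  have ht : ∀ x : ℝ, 4 * (c : ℝ) + 2 + 2 * (2 * x - 1) = 4 * (c : ℝ) + 4 * x := fun x => by ring
  -- the walk
  refine walk_sound (g := fun τ => (constQ Z : ℝ) + qSum Z ν fun μ => Real.cos ((4 * (c : ℝ) + 4 * τ) * μ))
    (g1 := fun τ => 4 * qSum Z ν fun μ => -μ * Real.sin ((4 * (c : ℝ) + 4 * τ) * μ))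
    (g2 := fun τ => 16 * qSum Z ν fun μ => -μ ^ 2 * Real.cos ((4 * (c : ℝ) + 4 * τ) * μ))
    (K := K) (Lr := (64 / 3) * ampC Z ν) hKpos ?_ (by rw [hK]; linarith) ?_ ?_ ?_ fuel mstart hcell hms
  · -- Taylor step
    intro τ u hu0 hu
    have := qSum_step (Z := Z) hν8 H.νmono H.ν0 (4 * (c : ℝ)) τ hu0 hu
    linarith
  · -- value
    intro m hm
    have hmR : m < MR := lt_of_lt_of_le hm hmend
    rw [horner_value (negFloor_spec Hl) hlenH hmR, hHl, evalZ_tauPoly]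
    have hv := cell_value (E := E) H hc1 hdig (hσ m hm)
    simp only [ht] at hv
    rw [← hG] at hv
    have := mul_le_mul_of_nonneg_left hv hMD
    rw [hK]
    nlinarith
  · -- first derivative
    intro m hm
    have hmR : m < MR := lt_of_lt_of_le hm hmend
    have hlen1 : (padTo (D' + 1) (derivZ Hl)).length = D' + 1 + 1 := length_padTo _ _
    rw [horner_value (negFloor_spec _) hlen1 hmR, evalZ_padTo ((length_derivZ _).trans hlenH.le), hHl, evalZ_derivZ_tauPoly]
    have hv := cell_deriv (E := E) H hc1 hdig (hσ m hm)
    simp only [ht] at hv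
    rw [← hG] at hv
    have := mul_le_mul_of_nonneg_left hv hMD
    rw [hK]
    nlinarith
  · -- second derivative
    intro m hm
    have hmR : m < MR := lt_of_lt_of_le hm hmend
    have hlen2 : (padTo (D' + 1) (derivZ (derivZ Hl))).length = D' + 1 + 1 := length_padTo _ _
    rw [horner_value (negFloor_spec _) hlen2 hmR,
      evalZ_padTo (((length_derivZ _).trans (length_derivZ _)).trans hlenH.le), hHl, evalZ_derivZ2_tauPoly]
    have hv := cell_deriv2 (E := E) H hc1 hdig (hσ m hm)
    simp only [ht] at hv
    rw [← hG] at hv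
    have := mul_le_mul_of_nonneg_left hv hMD
    rw [hK]
    nlinarith

end Summit.RiemannHypothesis.RiemannHypothesis.Theorems.IntegerScrew.Manifest.Fast
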